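import Mathlib
import Summits.Ventures.PercRepro2.IFRTail
import Summits.Ventures.PercRepro2.IFRConv
import Summits.Ventures.PercRepro2.IFRSP

/-!
# The flow of a random series–parallel network has the tail `SP.tail` (seat mine-b, cell pub-perc-repro2)

`IFRSP.lean` proves that the tail calculus `SP.tail` (edge ↦ `(…,1,1,p,0,…)`, series ↦ product,
parallel ↦ convolution) is log-concave.  Here we attach the calculus to an actual random variable:
a configuration of a series–parallel network `t` is an independent Bernoulli state of every edge
(`SP.Config`, product weight `SP.weight`), the **flow** `SP.flow` is computed recursively
(edge ↦ its state, series ↦ minimum, parallel ↦ sum — the number of edge-disjoint open terminal-to-terminal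
paths of a series–parallel network, by Menger; proofs/MINE-B-FLOW-IFR-SP.md §3), and
`SP.prob t k = Σ_ω weight ω · 1[k ≤ flow ω]` is the probability `P(F ≥ k)`.
Main results: `SP.prob_eq_tail : t.prob k = t.tail k` and hence `SP.prob_logconcave :
t.prob (k-1) * t.prob (k+1) ≤ t.prob k * t.prob k` — row B2 of conjectures/MINE-B.md for
series–parallel networks, now as a statement about the random flow itself.
-/

open Finset

namespace Summit.Ventures.PercRepro2.IFR

/-- configurations of a network: one Boolean per edge, arranged along the series–parallel tree -/
def SP.Config : SP → Type
  | .edge _ _ _ => Bool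
  | .series a b => a.Config × b.Config
  | .parallel a b => a.Config × b.Config

/-- the configuration space is finite -/
@[reducible] def SP.fintypeConfig : ∀ t : SP, Fintype t.Config
  | .edge _ _ _ => inferInstanceAs (Fintype Bool)
  | .series a b =>
      letI := a.fintypeConfig; letI := b.fintypeConfig
      inferInstanceAs (Fintype (a.Config × b.Config))
  | .parallel a b =>
      letI := a.fintypeConfig; letI := b.fintypeConfig
      inferInstanceAs (Fintype (a.Config × b.Config))

attribute [instance] SP.fintypeConfig

/-- the product (independent Bernoulli) weight of a configuration -/
noncomputable def SP.weight : ∀ t : SP, t.Config → ℝ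
  | .edge p _ _ => fun (b : Bool) => if b then p else 1 - p
  | .series a b => fun (ω : a.Config × b.Config) => a.weight ω.1 * b.weight ω.2
  | .parallel a b => fun (ω : a.Config × b.Config) => a.weight ω.1 * b.weight ω.2

/-- the flow of a configuration: an open edge carries 1, series = minimum, parallel = sum -/
def SP.flow : ∀ t : SP, t.Config → ℤ
  | .edge _ _ _ => fun (b : Bool) => if b then 1 else 0
  | .series a b => fun (ω : a.Config × b.Config) => min (a.flow ω.1) (b.flow ω.2)
  | .parallel a b => fun (ω : a.Config × b.Config) => a.flow ω.1 + b.flow ω.2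

/-- `P(F ≥ k)` -/
noncomputable def SP.prob (t : SP) (k : ℤ) : ℝ :=
  ∑ ω : t.Config, if k ≤ t.flow ω then t.weight ω else 0

/-- the flow is non-negative -/
theorem SP.flow_nonneg : ∀ (t : SP) (ω : t.Config), 0 ≤ t.flow ω
  | .edge _ _ _, b => by
      change Bool at b
      show (0 : ℤ) ≤ (if b then 1 else 0); split_ifs <;> norm_num
  | .series a b, ω => by
      show 0 ≤ min (a.flow ω.1) (b.flow ω.2)
      exact le_min (SP.flow_nonneg a ω.1) (SP.flow_nonneg b ω.2)
  | .parallel a b, ω => by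
      show 0 ≤ a.flow ω.1 + b.flow ω.2
      exact add_nonneg (SP.flow_nonneg a ω.1) (SP.flow_nonneg b ω.2)

/-- the flow is below the support bound of the tail calculus -/
theorem SP.flow_lt_bound : ∀ (t : SP) (ω : t.Config), t.flow ω < t.bound
  | .edge _ _ _, b => by
      change Bool at b
      show (if b then (1:ℤ) else 0) < 2; split_ifs <;> norm_num
  | .series a b, ω => by
      show min (a.flow ω.1) (b.flow ω.2) < min a.bound b.bound
      have h1 := SP.flow_lt_bound a ω.1; have h2 := SP.flow_lt_bound b ω.2
      exact lt_min (lt_of_le_of_lt (min_le_left _ _) h1) (lt_of_le_of_lt (min_le_right _ _) h2)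
  | .parallel a b, ω => by
      show a.flow ω.1 + b.flow ω.2 < a.bound + b.bound
      exact add_lt_add (SP.flow_lt_bound a ω.1) (SP.flow_lt_bound b ω.2)

/-- the weights are non-negative -/
theorem SP.weight_nonneg : ∀ (t : SP) (ω : t.Config), 0 ≤ t.weight ω
  | .edge p h0 h1, b => by
      change Bool at b
      show (0:ℝ) ≤ (if b then p else 1 - p); split_ifs <;> linarith
  | .series a b, ω => by
      show 0 ≤ a.weight ω.1 * b.weight ω.2
      exact mul_nonneg (SP.weight_nonneg a ω.1) (SP.weight_nonneg b ω.2)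
  | .parallel a b, ω => by
      show 0 ≤ a.weight ω.1 * b.weight ω.2
      exact mul_nonneg (SP.weight_nonneg a ω.1) (SP.weight_nonneg b ω.2)

/-- the probability that the flow equals `s` is the difference of two tail values -/
theorem SP.prob_sub (t : SP) (s : ℤ) :
    t.prob s - t.prob (s + 1) = ∑ ω : t.Config, if t.flow ω = s then t.weight ω else 0 := by
  unfold SP.prob
  rw [← Finset.sum_sub_distrib]
  refine Finset.sum_congr rfl fun ω _ => ?_
  by_cases h : t.flow ω = s
  · subst h; simp
  · by_cases h2 : s ≤ t.flow ω
    · have h3 : s + 1 ≤ t.flow ω := by omega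
      simp [h2, h3, h]
    · have h3 : ¬ s + 1 ≤ t.flow ω := by omega
      simp [h2, h3, h]

/-- the law of the flow is given by the tail calculus: `P(F ≥ k) = SP.tail k` -/
theorem SP.prob_eq_tail : ∀ (t : SP) (k : ℤ), t.prob k = t.tail k
  | .edge p h0 h1, k => by
      unfold SP.prob
      show (∑ b : Bool, if k ≤ (if b then (1:ℤ) else 0) then (if b then p else 1 - p) else 0) = edgeTail p k
      rw [Fintype.sum_bool]
      unfold edgeTail
      by_cases hk0 : k ≤ 0
      · have hk1 : k ≤ 1 := by omega
        simp [hk0, hk1]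
      · by_cases hk1 : k = 1
        · subst hk1; simp
        · have hk2 : ¬ k ≤ 1 := by omega
          simp [hk0, hk1, hk2]
  | .series a b, k => by
      unfold SP.prob
      show (∑ ω : a.Config × b.Config, if k ≤ min (a.flow ω.1) (b.flow ω.2) then a.weight ω.1 * b.weight ω.2 else 0)
          = a.tail k * b.tail k
      rw [← SP.prob_eq_tail a k, ← SP.prob_eq_tail b k]
      unfold SP.prob
      rw [Finset.sum_mul_sum, ← Finset.univ_product_univ, Finset.sum_product]
      refine Finset.sum_congr rfl fun x _ => Finset.sum_congr rfl fun y _ => ?_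
      by_cases h1 : k ≤ a.flow x <;> by_cases h2 : k ≤ b.flow y <;> simp [h1, h2]
  | .parallel a b, k => by
      unfold SP.prob
      show (∑ ω : a.Config × b.Config, if k ≤ a.flow ω.1 + b.flow ω.2 then a.weight ω.1 * b.weight ω.2 else 0)
          = Hsum a.tail b.tail (b.bound + 1) k
      unfold Hsum
      rw [← Finset.univ_product_univ, Finset.sum_product_right]
      -- inner sums: for fixed y, Σ_x 1[k ≤ fa x + fb y] wa x * wb y = wb y * a.prob (k - fb y)
      have hin : ∀ y : b.Config, (∑ x : a.Config, if k ≤ a.flow x + b.flow y then a.weight x * b.weight y else 0)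
          = b.weight y * a.tail (k - b.flow y) := by
        intro y
        rw [← SP.prob_eq_tail a, SP.prob, Finset.mul_sum]
        refine Finset.sum_congr rfl fun x _ => ?_
        by_cases h : k ≤ a.flow x + b.flow y
        · have h' : k - b.flow y ≤ a.flow x := by omega
          simp [h, h']; ring
        · have h' : ¬ k - b.flow y ≤ a.flow x := by omega
          simp [h, h']
      simp_rw [hin]
      -- group the y-sum by the value of the flow
      have hmaps : ∀ y ∈ (Finset.univ : Finset b.Config), b.flow y ∈ I (b.bound + 1) := by
        intro y _
        unfold I
        have h1 := SP.flow_nonneg b y; have h2 := SP.flow_lt_bound b y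
        simp only [Finset.mem_Icc]; omega
      rw [← Finset.sum_fiberwise_of_maps_to hmaps]
      refine Finset.sum_congr rfl fun s _ => ?_
      have h1 : (∑ i ∈ Finset.filter (fun i => b.flow i = s) Finset.univ, b.weight i * a.tail (k - b.flow i))
          = (∑ i ∈ Finset.filter (fun i => b.flow i = s) Finset.univ, b.weight i) * a.tail (k - s) := by
        rw [Finset.sum_mul]
        refine Finset.sum_congr rfl fun y hy => ?_
        rw [Finset.mem_filter] at hy
        rw [hy.2]
      rw [h1, Finset.sum_filter, ← SP.prob_sub b s, SP.prob_eq_tail b, SP.prob_eq_tail b]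
      rfl

/-- **Log-concavity of the flow tail of a random series–parallel network** (row B2 of MINE-B.md, series–parallel
case, for the random variable itself): `P(F ≥ k−1)·P(F ≥ k+1) ≤ P(F ≥ k)²`. -/
theorem SP.prob_logconcave (t : SP) (k : ℤ) :
    t.prob (k - 1) * t.prob (k + 1) ≤ t.prob k * t.prob k := by
  rw [SP.prob_eq_tail, SP.prob_eq_tail, SP.prob_eq_tail]
  exact SP.tail_logconcave t k

/-- the weights form a probability distribution (total mass one) -/
theorem SP.sum_weight (t : SP) : ∑ ω : t.Config, t.weight ω = 1 := by
  have h := SP.prob_eq_tail t 0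
  rw [(SP.tail_isLCTail t).one 0 le_rfl] at h
  rw [← h]
  unfold SP.prob
  refine Finset.sum_congr rfl fun ω _ => ?_
  have := SP.flow_nonneg t ω
  simp [this]

end Summit.Ventures.PercRepro2.IFR
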